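import Literature.MathematicalPhysics.QuantumFieldTheory.Balaban1983to89.B15DeterminingSets
import Literature.MathematicalPhysics.QuantumFieldTheory.Balaban1983to89.B6SectADomainsV1
import Literature.MathematicalPhysics.QuantumFieldTheory.BalabanImbrieJaffe1984to88.BIJ88RT51Background

/-!
# NODE 00 — THE INDEX SET OF THE MULTI-SCALE FIBRE: [III] (2.2)∕(2.10) READ WITH `bondsOf` («bonds MEETING Γ_j», `B15DeterminingSets` reading (b)) VERSUS
# [Balaban1984PropagatorsII] (2.3) `Λ_j = st(Ω_j)∖st(Ω_{j+1})` (`B6SectADomainsV1.Domains.LamBond`) — the set algebra of the located junction FINDING A, kernel-checked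

Cell `pub-ymgap`, width seat `pub-ymgap-dag-n07-w2` generation 0 (HUMAN RULING D-0149; DAG node N07 = [15]; plan g77∕g78 W-SEAT START LIST §n07 S2; AUDIT-S2 FINDING A, INBOX l.24275).
NEW leaf; CONSUMED BY NAME, nothing modified: r12's `B15DeterminingSets` (`genSet`, `gammaRegion`, `pts`, `embIter`, `bondsOf`), p21's `B6SectADomainsV1.Domains` (`Om`, `Deep`, `LamSite`,
`LamBond`, `InOm`), p39's `B5Eq118OneStroke.iterBlockOf` and `BIJ88RT51Background.iterBlockOf_embIter`.  `--kind proof --supports stmt-QuantumFields-20542` (K1⁷; count-neutral; theorems only).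

WHY.  Stub 1's token (K0⁷, `Prop8RegSepTopStep`) reads the multi-scale fibre as `AgreeOn (genSet s.Ω k) …`, i.e. agreement on the bonds MEETING `Γ_j = (Ω_j∖Ω_{j+1})^{(j)}` ([III] (2.2),
(2.10); `B15DeterminingSets` READING (b), citing [I] p.251 and [IV] p.195).  Every object of the route UnitScaleTilt and of lit-balaban's B6 chain that a «UST transfer» would cite at NODE 00 —
print's `H` with (45) `Q(HB) = B` (`FlatCubeOperators.QE_hOp`), `G̃`, the onto-ness of the multi-level constraint (`B6SectAOntoV1.exists_constr`), `FlatCubeConstraintsFibre.constraints_sub_fibre` — is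
indexed by [Balaban1984PropagatorsII] (2.3): `Λ_j` = the `j`-bonds with «at least one end-point in Ω_j, NO end-point deep (block inside Ω_{j+1})» (`Domains.LamBond`).  THIS FILE computes the
relation between the two index sets for the block-measurable region family `Ω_j := {x | iterBlockOf j x ∈ D.Om j}` of a nested family `D : Domains P` (the family UST's `FlatCubeLevels` reads):
(i) the SITES agree — `Γ_j`-points are exactly B6's `LamSite` (`mem_genSet_inOm_iff`); (ii) on BONDS reading (b) is `LamSite b₋ ∨ LamSite b₊` while (2.3) is `(b₋ ∈ Ω_j ∨ b₊ ∈ Ω_j) ∧ ¬Deep b₋ ∧ ¬Deep b₊`,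
so `Λ_j^{B6} ⊆ bondsOf Γ_j` (`mem_bondsOf_genSet_inOm_of_lamBond`) and the DIFFERENCE is exactly the set of `j`-bonds with one end-point in `Γ_j` and the other DEEP — the bonds connecting `Γ_j` to
`Ω_{j+1}` (`mem_bondsOf_genSet_inOm_and_not_lamBond_iff`).  These are the «crossing pins at ∂Ω_{j+1}» of n07-e's LOCATED-MULTISCALE-FIBRE § A∕§ B.  ANSWER OF RECORD (cell pub-ymgap
ME #35, lit-balaban desk lead g28 + iface-1 co-read, 2026-08-27 23:34Z, INBOX l.24840): the two readings are ONE printed object ([15] p.277 = [III] (2.2): `Λ_j = Ω_j^{(j)}∖Ω_{j+1}^{(j)}`,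
no bond formula printed); the bond set is fixed by print's invariance statements ([15] (4), [6] (1.13)–(1.14), [B6] (2.6)–(2.7)), which hold for (2.3) = `LamBond` and FAIL for reading (b) —
pub-balaban audit row GAPS G-adv8-10 with the ℤᵈ certificate `B8ConstraintBonds` (`literalBonds ⊋ bondsB ⊋ bondsA`, `literal_not_Invariant`).  THIS FILE is the TORUS dictionary between the
tree's two typed objects (`B15DeterminingSets.genSet`∕`bondsOf` over `Site P j` and `B6SectADomainsV1.Domains.LamBond`), so that a consumer can pass from the K0 fibre's index set to the
(2.3)-indexed objects of the route UnitScaleTilt ∕ lit-balaban B6 and see exactly which bonds are over-pinned; it adjudicates nothing itself.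

CONTENTS.  `inOm_embIter_iff`, `inOm_succ_embIter_iff` (the two dictionary lines), ★ `mem_genSet_inOm_iff`, ★ `mem_bondsOf_genSet_inOm_iff`, `mem_bondsOf_genSet_inOm_of_lamBond`,
`lamBond_iff_mem_bondsOf_genSet_inOm`, ★★ `mem_bondsOf_genSet_inOm_and_not_lamBond_iff`.

HONEST FRAMING: finite set algebra between two typed readings; nothing of the papers asserted; no definition; stub 1 ∕ K0⁷ untouched (its reading stands as typed); N07 NOT discharged;
counts unmoved (5∕27); one finite T⁴ programme at fixed ε — NOT continuum ∕ ℝ⁴ ∕ OS ∕ mass gap ∕ Clay.  No `sorry`, no `instance`, no `notation`.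
-/

namespace Literature.MathematicalPhysics.QuantumFieldTheory.Balaban1983to89.Node00

open B15DeterminingSets B5Eq118OneStroke
open B6SectADomainsV1 (Domains)
open BalabanImbrieJaffe1984to88.BIJ88RT51Background (iterBlockOf_embIter)

variable {P : Params} (D : Domains P)

/-- Dictionary, line 1: the centre of a `j`-lattice point lies in the block-measurable region `Ω_j` iff the point lies in `Ω_j^{(j)}` (standing range `j ≤ m + K`).
[cite: Balaban1987RG1, (0.1) p.251 («Each lattice determines a lattice of centers»); Balaban1984PropagatorsII, (2.1) p.224] -/
theorem inOm_embIter_iff {j : ℕ} (hj : j ≤ P.m + P.K) (y : Site P j) : D.InOm j (embIter j y) ↔ y ∈ D.Om j := by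
  unfold Domains.InOm
  rw [iterBlockOf_embIter j hj y]

/-- Dictionary, line 2: the centre of a `j`-lattice point lies in `Ω_{j+1}` iff the point is DEEP at level `j` (its block is in `Ω_{j+1}^{(j+1)}`).
[cite: Balaban1984PropagatorsII, (2.3) p.224] -/
theorem inOm_succ_embIter_iff {j : ℕ} (hj : j ≤ P.m + P.K) (y : Site P j) : D.InOm (j + 1) (embIter j y) ↔ D.Deep j y := by
  unfold Domains.InOm Domains.Deep
  rw [iterBlockOf_succ, iterBlockOf_embIter j hj y]

/-- ★ **SITES AGREE**: the member `Γ_j` of [III] (2.2)'s determining set of the region family `Ω_j = {x | iterBlockOf j x ∈ Ω_j^{(j)}}` IS [Balaban1984PropagatorsII] (2.3)'s `Λ_j` (sites):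
`y ∈ Γ_j ⟺ y ∈ Ω_j^{(j)} ∧ ¬Deep_j y` — at every level (`Γ₀ = Ω₁ᶜ`, `Γ_j = Ω_j∖Ω_{j+1}`, `Γ_k = Ω_k`, nothing above `k`).
[cite: Balaban1988Convergent, (2.2) p.255; Balaban1984PropagatorsII, (2.3) p.224] -/
theorem mem_genSet_inOm_iff (j : ℕ) (y : Site P j) : y ∈ genSet (fun i => {x : Site P 0 | D.InOm i x}) D.k j ↔ D.LamSite j y := by
  rw [genSet, mem_pts, gammaRegion]
  by_cases hkj : D.k < j
  · rw [if_pos hkj]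
    simp only [Set.mem_empty_iff_false, Domains.LamSite, D.Om_eq_empty hkj, Finset.notMem_empty, false_and]
  rw [if_neg hkj]
  have hjk : j ≤ D.k := not_lt.1 hkj
  have hj : j ≤ P.m + P.K := hjk.trans D.hk
  by_cases hjeq : j = D.k
  · rw [if_pos hjeq]
    show D.InOm D.k (embIter j y) ↔ _
    have h1 : D.InOm D.k (embIter j y) ↔ y ∈ D.Om j := by subst hjeq; exact inOm_embIter_iff D hj y
    rw [h1, Domains.LamSite]
    have hnd : ¬ D.Deep j y := by
      unfold Domains.Deep
      rw [D.Om_eq_empty (by omega)]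
      exact Finset.notMem_empty _
    exact ⟨fun h => ⟨h, hnd⟩, fun h => h.1⟩
  rw [if_neg hjeq]
  by_cases hj0 : j = 0
  · subst hj0
    rw [if_pos rfl, Set.mem_compl_iff]
    show ¬ D.InOm 1 (embIter 0 y) ↔ _
    rw [inOm_succ_embIter_iff D hj, Domains.lamSite_zero_iff]
  · rw [if_neg hj0, Set.mem_sdiff]
    show D.InOm j (embIter j y) ∧ ¬ D.InOm (j + 1) (embIter j y) ↔ _
    rw [inOm_embIter_iff D hj, inOm_succ_embIter_iff D hj]
    rfl

/-- ★ **BONDS, READING (b)**: a `j`-bond is a constrained bond of the fibre `AgreeOn (genSet Ω k)` («meets `Γ_j`», `bondsOf`) iff ONE of its end-points is a `Λ_j`-site of (2.3).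
[cite: Balaban1988Convergent, (2.10) p.256; Balaban1987RG1, (0.1) p.251; Balaban1984PropagatorsII, (2.3) p.224] -/
theorem mem_bondsOf_genSet_inOm_iff (j : ℕ) (b : PBond P j) :
    b ∈ bondsOf (genSet (fun i => {x : Site P 0 | D.InOm i x}) D.k j) ↔ D.LamSite j b.src ∨ D.LamSite j b.tgt := by
  show b.src ∈ _ ∨ b.tgt ∈ _ ↔ _
  rw [mem_genSet_inOm_iff, mem_genSet_inOm_iff]

/-- **[B6] (2.3) ⊆ READING (b)**: every bond of `Λ_j = st(Ω_j)∖st(Ω_{j+1})` («at least one end-point in Ω_j, no end-point deep») meets `Γ_j`.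
[cite: Balaban1984PropagatorsII, (2.3) p.224; Balaban1988Convergent, (2.10) p.256] -/
theorem mem_bondsOf_genSet_inOm_of_lamBond {j : ℕ} {b : PBond P j} (hb : D.LamBond j b) : b ∈ bondsOf (genSet (fun i => {x : Site P 0 | D.InOm i x}) D.k j) := by
  rw [mem_bondsOf_genSet_inOm_iff]
  obtain ⟨h | h, hs, ht⟩ := hb
  · exact Or.inl ⟨h, hs⟩
  · exact Or.inr ⟨h, ht⟩

/-- **(2.3) inside reading (b)**: `Λ_j` is the set of bonds meeting `Γ_j` with NO deep end-point. [cite: Balaban1984PropagatorsII, (2.3) p.224; Balaban1988Convergent, (2.10) p.256] -/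
theorem lamBond_iff_mem_bondsOf_genSet_inOm {j : ℕ} (b : PBond P j) :
    D.LamBond j b ↔ b ∈ bondsOf (genSet (fun i => {x : Site P 0 | D.InOm i x}) D.k j) ∧ ¬ D.Deep j b.src ∧ ¬ D.Deep j b.tgt := by
  rw [mem_bondsOf_genSet_inOm_iff]
  constructor
  · rintro ⟨h | h, hs, ht⟩
    · exact ⟨Or.inl ⟨h, hs⟩, hs, ht⟩
    · exact ⟨Or.inr ⟨h, ht⟩, hs, ht⟩
  · rintro ⟨h | h, hs, ht⟩
    · exact ⟨Or.inl h.1, hs, ht⟩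
    · exact ⟨Or.inr h.1, hs, ht⟩

/-- ★★ **THE DIFFERENCE SET**: a `j`-bond is constrained under reading (b) but NOT under [Balaban1984PropagatorsII] (2.3) iff one end-point lies in `Γ_j` and the OTHER IS DEEP (its block lies in
`Ω_{j+1}^{(j+1)}`) — the bonds connecting `Γ_j` to `Ω_{j+1}` (the «crossing pins at ∂Ω_{j+1}»).  This is the located index-set junction every transfer of the (2.3)-indexed objects (`H` of (45)∕(157),
`G̃`, the onto-ness of the multi-level constraint) to the `genSet`-indexed fibre meets. [cite: Balaban1988Convergent, (2.2) p.255, (2.10) p.256; Balaban1984PropagatorsII, (2.3) p.224] -/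
theorem mem_bondsOf_genSet_inOm_and_not_lamBond_iff {j : ℕ} (b : PBond P j) :
    b ∈ bondsOf (genSet (fun i => {x : Site P 0 | D.InOm i x}) D.k j) ∧ ¬ D.LamBond j b ↔
      (D.LamSite j b.src ∧ D.Deep j b.tgt) ∨ (D.LamSite j b.tgt ∧ D.Deep j b.src) := by
  rw [mem_bondsOf_genSet_inOm_iff]
  simp only [Domains.LamBond, Domains.LamSite, not_and_or, not_not, not_or]
  tauto

end Literature.MathematicalPhysics.QuantumFieldTheory.Balaban1983to89.Node00
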